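import Summits.HubbardSuperconductivity.HubbardSuperconductivity.Theorems.AnisotropyChordTransferFibre3RowDLoopXMajE
import Summits.HubbardSuperconductivity.HubbardSuperconductivity.Theorems.AnisotropyChordTransferFibre3RowDCheckWS
import Summits.HubbardSuperconductivity.HubbardSuperconductivity.Theorems.AnisotropyChordTransferFibre3RowDReal

/-!
# Route `AnisotropyChord` / H0 rotor rung, row D (KT-2a) STAGE 2: the cell program with the certified-table `SSS` majorant —
`termEX`, zero-order and first-order class checks, ★★★ orbit-form soundness

Continuation of `…RowDLoopXMajE` (Stage-2 loop majorant `majEX czE ws`).  As in p1's `…RowDCellCheckW` (generic zone atom `czE`) and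
p2's `…RowDCheckWS` (first-order rows):
* ★★ `rhat_norm_leX`: `‖R̂′(k̄)‖ ≤ V²t·(|x_k| + (majEX czE ws).eval)` under the zone hypotheses and the table hypothesis `hws` of the class;
* `termEX czE ws τlo τhi k₂ k₃ = (|x_k| + majEX)²/(ê_k − τhi)`, ★ `class_leX`;
* ★ `classCheckX` (zero order, `rexprLeOn`) / ★ `classCheckXS` (first order, `L2.sdEnclose` on `envC` of the row-D box), soundness;
* ★★★ `lowG_of_orbitChecksXS` (generic `czE`, `repsZ ++ repsS`, table hypotheses per class of `lowList`) and the hypothesis-light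
  ★★★ `lowG_of_orbitChecksWXS`: the `c_W` program with a certified table — inputs `ws`, `dset`,
  `hcov : ∀ kk ∈ lowList, ∀ d ∈ sssShifts kk, d ∈ dset` (= `B1.wsDSetB<band>_covers`) and
  `hadm : ∀ e ∈ E4, ∀ d ∈ dset, θ⁴·B1.wloopSum L (ν·θ²) 0 d d e e ≤ ws e d` at `ν = λ₂/θ²` (= `B1.wsTabB<band>_adm L hL ν hν0 hν`) ⟹
  `lowGForm ≤ a_D·η_eff·U` on the cell for every `L ≥ 128` (the `hKT2a` input of `gm3_of_cell` / `L2.cell_closed`).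
Per-class certified `SSS` constant 36–42 vs `18c_WŜ₂ ≈ 111–118` (Stage 1.5) vs `18c_ZŜ₂ ≈ 277–304` (Stage 1) (p2 g7 REPORT 1).
Prover seat `hubbard-h0-rotor-p2` g7; helper for piece A = stmt-HubbardSuperconductivity-23918 of rung 19089
(`--supports`, helper class).  Nothing here proves superconductivity in the Hubbard model; ONE row of ONE conditional reduction, cell by cell;
the rotor TARGET as originally worded stays FALSE (g15 verdict).  Tree imports only; no sorry.
-/

set_option linter.dupNamespace false
set_option autoImplicit false

open scoped BigOperators
open Literature.Analysis.ValidatedNumerics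

namespace Summit.HubbardSuperconductivity.HubbardSuperconductivity.Theorems.AnisotropyChord.Transfer.Fibre3

namespace RowD

open RowC L2 L2.N1

variable (L : ℕ) [NeZero L]

/-! ## The program -/

/-- one class of the Stage-2 program: `(|x| + majEX czE ws)²/(ê_k − τhi)`. -/
def termEX (czE : RExpr) (ws : ℤ × ℤ → ℤ × ℤ → ℚ) (τlo τhi : ℚ) (k₂ k₃ : ℤ × ℤ) : RExpr :=
  .mul (.sq (.add (.abs (rhoE k₂ k₃).1) (majEX czE ws τlo τhi k₂ k₃))) (.inv (.sub (denHE k₂ k₃) (cst τhi)))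

/-- ★ ZERO-ORDER check of ONE class of the Stage-2 program against a rational budget `b`. -/
def classCheckX (czE : RExpr) (ws : ℤ × ℤ → ℤ × ℤ → ℚ) (c : L2.NamedCell) (a1 a2 τlo τhi : ℚ) (pi : ℕ × ℕ)
    (kk : (ℤ × ℤ) × (ℤ × ℤ)) (b : ℚ) : Bool :=
  match rowDBox c a1 a2 pi with
  | none => false
  | some B => rexprLeOn (termEX czE ws τlo τhi kk.1 kk.2) b B pi

/-- ★ FIRST-ORDER check of ONE class of the Stage-2 program against a rational budget `b`. -/
def classCheckXS (czE : RExpr) (ws : ℤ × ℤ → ℤ × ℤ → ℚ) (c : L2.NamedCell) (a1 a2 τlo τhi : ℚ) (pi : ℕ × ℕ)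
    (kk : (ℤ × ℤ) × (ℤ × ℤ)) (b : ℚ) : Bool :=
  match rowDBox c a1 a2 pi with
  | none => false
  | some B =>
    match sdEnclose pi.1 pi.2 (envC B) (termEX czE ws τlo τhi kk.1 kk.2) with
    | none => false
    | some M => decide (M.ub (incrI (B.toIvl 2) (midI (B.toIvl 2))) (incrI (B.toIvl 3) (midI (B.toIvl 3))) ≤ b)

/-- the `c_W` Stage-2 checks (zone atom `cWE`). -/
def classCheckWX (ws : ℤ × ℤ → ℤ × ℤ → ℚ) (c : L2.NamedCell) (a1 a2 τlo τhi : ℚ) (pi : ℕ × ℕ) (kk : (ℤ × ℤ) × (ℤ × ℤ)) (b : ℚ) : Bool :=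
  classCheckX cWE ws c a1 a2 τlo τhi pi kk b
/-- see `classCheckWX` (first order). -/
def classCheckWXS (ws : ℤ × ℤ → ℤ × ℤ → ℚ) (c : L2.NamedCell) (a1 a2 τlo τhi : ℚ) (pi : ℕ × ℕ) (kk : (ℤ × ℤ) × (ℤ × ℤ)) (b : ℚ) : Bool :=
  classCheckXS cWE ws c a1 a2 τlo τhi pi kk b

omit [NeZero L] in
/-- ★ soundness of the first-order Stage-2 class check. -/
theorem classCheckXS_sound {czE : RExpr} {ws : ℤ × ℤ → ℤ × ℤ → ℚ} {c : L2.NamedCell} {a1 a2 τlo τhi : ℚ} {pi : ℕ × ℕ}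
    {kk : (ℤ × ℤ) × (ℤ × ℤ)} {b : ℚ}
    (h : classCheckXS czE ws c a1 a2 τlo τhi pi kk b = true) {B : Box} (hB : rowDBox c a1 a2 pi = some B)
    {x : ℕ → ℝ} (hx : B.mem x) :
    (termEX czE ws τlo τhi kk.1 kk.2).eval x ≤ ((b : ℚ) : ℝ) := by
  unfold classCheckXS at h
  rw [hB] at h
  simp only at h
  split at h
  · exact absurd h (by simp)
  · rename_i M hM
    have hb : M.ub (incrI (B.toIvl 2) (midI (B.toIvl 2))) (incrI (B.toIvl 3) (midI (B.toIvl 3))) ≤ b := of_decide_eq_true h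
    have hbd := sdEnclose_bounds (holds_envC hx) (incr_mem hx 2) (incr_mem hx 3) _ hM
    exact hbd.2.trans (by exact_mod_cast hb)

/-! ## Soundness -/

section sound
variable (Δ lam2 : ℝ) (f : Tor L → ℝ)

/-- ★★ THE STAGE-2 NORM BOUND of a low coefficient (generic zone constant for the non-`SSS` families, certified table for `SSS`) (ground profile located in a row-D cell, `L ≥ 128`; `τlo·θ² ≤ T⁺ ≤ τhi·θ²`; `rhoOk k`). -/
theorem rhat_norm_leX (czE : RExpr) {cz : ℝ} (hc : 0 ≤ cz)
    (hwg : ∀ q : Tor L, ∀ e ∈ E4, (wnorm L q (B1.toTor L e) * gres L lam2 q) ^ 2 ≤ cz * gres L lam2 q)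
    (hcz : czE.eval (xTrueD L Δ lam2 f) = cz) (hL : 128 ≤ L) (hΔ0 : 0 ≤ Δ) (hΔ1 : Δ < 1) (hf : IsGroundTwoMagnon L Δ lam2 f)
    (τlo τhi : ℚ) (hτlo : (τlo : ℝ) * (2 * Real.pi / L) ^ 2 ≤ Tplus L Δ f) (hτhi : Tplus L Δ f ≤ (τhi : ℝ) * (2 * Real.pi / L) ^ 2)
    (ws : ℤ × ℤ → ℤ × ℤ → ℚ) {k₂ k₃ : ℤ × ℤ} (hok : rhoOk k₂ k₃ = true)
    (hws : ∀ e ∈ E4, ∀ d ∈ sssShifts (k₂, k₃), ((2 * Real.pi / L) ^ 2) ^ 2 * B1.wloopSum L lam2 0 d d e e ≤ wsR ws e d) :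
    ‖cfgDFT L (resid L Δ f) (B1.toTor L k₂) (B1.toTor L k₃)‖
      ≤ ((L : ℝ) ^ 2) ^ 2 * (2 * Real.pi / L) ^ 2 *
        (|(rhoE k₂ k₃).1.eval (xTrueD L Δ lam2 f)| + (majEX czE ws τlo τhi k₂ k₃).eval (xTrueD L Δ lam2 f)) := by
  have hLpos : (0 : ℝ) < L := by exact_mod_cast (show 0 < L by omega)
  have hθ : 0 < (2 * Real.pi / L : ℝ) := by positivity
  have ht : 0 < (2 * Real.pi / L : ℝ) ^ 2 := by positivity
  have hV : (0 : ℝ) < (L : ℝ) ^ 2 := by positivity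
  have hlam : 0 < lam2 := lam2_pos L (by omega) hΔ1 hf.1
  have hreal := rhat_norm_eq_abs_re L hf (B1.toTor L k₂) (B1.toTor L k₃)
  rw [hreal, rhat_decomp_eval L Δ lam2 f (by omega) hΔ0 hΔ1 hf hlam 0 hok]
  have hnV : ‖((L : ℂ) ^ 2) ^ 2‖ = ((L : ℝ) ^ 2) ^ 2 := by rw [norm_pow, norm_pow]; simp
  -- piece A: the closed pair, real part
  have hA : (((L : ℂ) ^ 2) ^ 2 * ((((2 * Real.pi / L) ^ 2 : ℝ) : ℂ) * peval (2 * Real.pi / L) (xTrueD L Δ lam2 f) (rhoE k₂ k₃))).re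
      = ((L : ℝ) ^ 2) ^ 2 * (2 * Real.pi / L) ^ 2 * (rhoE k₂ k₃).1.eval (xTrueD L Δ lam2 f) := by
    unfold peval
    simp only [Complex.mul_re, Complex.add_re, Complex.ofReal_re, Complex.ofReal_im, Complex.mul_im, Complex.I_re, Complex.I_im,
      Complex.add_im]
    have : (((L : ℂ) ^ 2) ^ 2).re = ((L : ℝ) ^ 2) ^ 2 ∧ (((L : ℂ) ^ 2) ^ 2).im = 0 := by
      constructor
      · norm_cast
      · norm_cast
    rw [this.1, this.2]
    ring
  -- piece B: the loops
  have hB := loopTot_leX L Δ lam2 f czE hc hwg hcz hL hΔ0 hΔ1 hf 0 ws k₂ k₃ hws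
  -- piece C: the NT term
  have hν2 : xTrueD L Δ lam2 f 2 = lam2 / (2 * Real.pi / L) ^ 2 := xTrueD_two L Δ lam2 f
  have hτ : |Tplus L Δ f - 3 * lam2| ≤ (2 * Real.pi / L) ^ 2 * (tdevE τlo τhi).eval (xTrueD L Δ lam2 f) := by
    simp only [tdevE, RExpr.eval, cst, vNu, hν2]
    push_cast
    have h3 : Tplus L Δ f - 3 * lam2
        = (2 * Real.pi / L) ^ 2 * (Tplus L Δ f / (2 * Real.pi / L) ^ 2 - 3 * (lam2 / (2 * Real.pi / L) ^ 2)) := by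
      field_simp
    rw [h3, abs_mul, abs_of_pos ht]
    refine mul_le_mul_of_nonneg_left ?_ ht.le
    apply abs_le_max_abs_abs
    · have : (τlo : ℝ) ≤ Tplus L Δ f / (2 * Real.pi / L) ^ 2 := by rw [le_div_iff₀ ht]; exact hτlo
      linarith
    · have : Tplus L Δ f / (2 * Real.pi / L) ^ 2 ≤ (τhi : ℝ) := by rw [div_le_iff₀ ht]; exact hτhi
      linarith
  have hC : ‖(((Tplus L Δ f - 3 * lam2 : ℝ) : ℂ))
        * (((L : ℂ) ^ 2) ^ 2 * ((((ntClosedE k₂ k₃).eval (xTrueD L Δ lam2 f) : ℝ)) : ℂ) + ntLoopU L Δ lam2 f 0 (B1.toTor L k₂) (B1.toTor L k₃))‖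
      ≤ ((L : ℝ) ^ 2) ^ 2 * (2 * Real.pi / L) ^ 2 * (majNTE τlo τhi k₂ k₃).eval (xTrueD L Δ lam2 f) := by
    rw [norm_mul, Complex.norm_real, Real.norm_eq_abs]
    have hin : ‖((L : ℂ) ^ 2) ^ 2 * ((((ntClosedE k₂ k₃).eval (xTrueD L Δ lam2 f) : ℝ)) : ℂ) + ntLoopU L Δ lam2 f 0 (B1.toTor L k₂) (B1.toTor L k₃)‖
        ≤ ((L : ℝ) ^ 2) ^ 2 * (|(ntClosedE k₂ k₃).eval (xTrueD L Δ lam2 f)| + 3 * ntBndE.eval (xTrueD L Δ lam2 f)) := by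
      have h1 : ‖((L : ℂ) ^ 2) ^ 2 * ((((ntClosedE k₂ k₃).eval (xTrueD L Δ lam2 f) : ℝ)) : ℂ)‖ = ((L : ℝ) ^ 2) ^ 2 * |(ntClosedE k₂ k₃).eval (xTrueD L Δ lam2 f)| := by
        rw [norm_mul, Complex.norm_real, Real.norm_eq_abs, hnV]
      have h2 := ntLoop_le L Δ lam2 f hL hΔ0 hΔ1 hf 0 (B1.toTor L k₂) (B1.toTor L k₃)
      refine (norm_add_le _ _).trans ?_
      rw [h1]
      linarith
    have hdev0 : 0 ≤ (2 * Real.pi / L) ^ 2 * (tdevE τlo τhi).eval (xTrueD L Δ lam2 f) := le_trans (abs_nonneg _) hτ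
    calc |Tplus L Δ f - 3 * lam2| * ‖((L : ℂ) ^ 2) ^ 2 * ((((ntClosedE k₂ k₃).eval (xTrueD L Δ lam2 f) : ℝ)) : ℂ) + ntLoopU L Δ lam2 f 0 (B1.toTor L k₂) (B1.toTor L k₃)‖
        ≤ ((2 * Real.pi / L) ^ 2 * (tdevE τlo τhi).eval (xTrueD L Δ lam2 f)) * (((L : ℝ) ^ 2) ^ 2 * (|(ntClosedE k₂ k₃).eval (xTrueD L Δ lam2 f)| + 3 * ntBndE.eval (xTrueD L Δ lam2 f))) :=
          mul_le_mul hτ hin (norm_nonneg _) hdev0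
      _ = ((L : ℝ) ^ 2) ^ 2 * (2 * Real.pi / L) ^ 2 * (majNTE τlo τhi k₂ k₃).eval (xTrueD L Δ lam2 f) := by
          simp only [majNTE, RExpr.eval, cst]; push_cast; ring
  -- assemble: `|Re(A + B − C)| ≤ |Re A| + ‖B‖ + ‖C‖`
  simp only [majEX, RExpr.eval]
  rw [Complex.sub_re, Complex.add_re, hA]
  have hBre := (Complex.abs_re_le_norm (loopTot L Δ lam2 f 0 (B1.toTor L k₂) (B1.toTor L k₃))).trans hB
  have hCre := (Complex.abs_re_le_norm ((((Tplus L Δ f - 3 * lam2 : ℝ) : ℂ))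
        * (((L : ℂ) ^ 2) ^ 2 * ((((ntClosedE k₂ k₃).eval (xTrueD L Δ lam2 f) : ℝ)) : ℂ)
          + ntLoopU L Δ lam2 f 0 (B1.toTor L k₂) (B1.toTor L k₃)))).trans hC
  have hVt : 0 ≤ ((L : ℝ) ^ 2) ^ 2 * (2 * Real.pi / L) ^ 2 := by positivity
  have hx : |((L : ℝ) ^ 2) ^ 2 * (2 * Real.pi / L) ^ 2 * (rhoE k₂ k₃).1.eval (xTrueD L Δ lam2 f)|
      = ((L : ℝ) ^ 2) ^ 2 * (2 * Real.pi / L) ^ 2 * |(rhoE k₂ k₃).1.eval (xTrueD L Δ lam2 f)| := by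
    rw [abs_mul, abs_of_nonneg hVt]
  have habs := abs_sub (((L : ℝ) ^ 2) ^ 2 * (2 * Real.pi / L) ^ 2 * (rhoE k₂ k₃).1.eval (xTrueD L Δ lam2 f)
      + (loopTot L Δ lam2 f 0 (B1.toTor L k₂) (B1.toTor L k₃)).re)
    ((((Tplus L Δ f - 3 * lam2 : ℝ) : ℂ)) * (((L : ℂ) ^ 2) ^ 2 * ((((ntClosedE k₂ k₃).eval (xTrueD L Δ lam2 f) : ℝ)) : ℂ)
        + ntLoopU L Δ lam2 f 0 (B1.toTor L k₂) (B1.toTor L k₃))).re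
  have hadd := abs_add_le (((L : ℝ) ^ 2) ^ 2 * (2 * Real.pi / L) ^ 2 * (rhoE k₂ k₃).1.eval (xTrueD L Δ lam2 f))
    (loopTot L Δ lam2 f 0 (B1.toTor L k₂) (B1.toTor L k₃)).re
  rw [hx] at hadd
  linarith [habs, hadd, hBre, hCre]


/-- ★ one class, Stage 2: `|R̂′(k̄)|²/(V²·den(k̄)) ≤ V²t·(termEX czE ws).eval`. [folklore] -/
theorem class_leX (czE : RExpr) {cz : ℝ} (hcz0 : 0 ≤ cz)
    (hwg : ∀ q : Tor L, ∀ e ∈ E4, (wnorm L q (B1.toTor L e) * gres L lam2 q) ^ 2 ≤ cz * gres L lam2 q)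
    (hcz : czE.eval (xTrueD L Δ lam2 f) = cz) (hL : 128 ≤ L) (hΔ0 : 0 ≤ Δ) (hΔ1 : Δ < 1) (hf : IsGroundTwoMagnon L Δ lam2 f)
    (τlo τhi : ℚ) (hτlo : (τlo : ℝ) * (2 * Real.pi / L) ^ 2 ≤ Tplus L Δ f) (hτhi : Tplus L Δ f ≤ (τhi : ℝ) * (2 * Real.pi / L) ^ 2)
    (he1 : (τhi : ℝ) - 2 * (eps1 L / (2 * Real.pi / L) ^ 2) ≤ -1 / 1000)
    (ws : ℤ × ℤ → ℤ × ℤ → ℚ) {kk : (ℤ × ℤ) × (ℤ × ℤ)} (hkk : kk ∈ lowList)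
    (hws : ∀ e ∈ E4, ∀ d ∈ sssShifts kk, ((2 * Real.pi / L) ^ 2) ^ 2 * B1.wloopSum L lam2 0 d d e e ≤ wsR ws e d) :
    Complex.normSq (cfgDFT L (resid L Δ f) (B1.toTor L kk.1) (B1.toTor L kk.2))
        / (((L : ℝ) ^ 2) ^ 2 * den L (Tplus L Δ f) (B1.toTor L kk.1) (B1.toTor L kk.2))
      ≤ ((L : ℝ) ^ 2) ^ 2 * (2 * Real.pi / L) ^ 2 * (termEX czE ws τlo τhi kk.1 kk.2).eval (xTrueD L Δ lam2 f) := by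
  have hLpos : (0 : ℝ) < L := by exact_mod_cast (show 0 < L by omega)
  have ht : 0 < (2 * Real.pi / L : ℝ) ^ 2 := by positivity
  have hV : (0 : ℝ) < (L : ℝ) ^ 2 := by positivity
  obtain ⟨hok, hden⟩ := ok_of_mem hkk
  -- the norm bound
  have hR := rhat_norm_leX L Δ lam2 f czE hcz0 hwg hcz hL hΔ0 hΔ1 hf τlo τhi hτlo hτhi ws hok hws
  set A : ℝ := |(rhoE kk.1 kk.2).1.eval (xTrueD L Δ lam2 f)| + (majEX czE ws τlo τhi kk.1 kk.2).eval (xTrueD L Δ lam2 f) with hA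
  -- the denominator
  have hmem : (B1.toTor L kk.1, B1.toTor L kk.2) ∈ lowSet L := mem_lowSet_of_mem_lowList L (by omega) hkk
  have hdlow := den_ge_of_mem_lowSet L (by omega) (Tplus L Δ f) hmem
  have ed := eval_denHE L Δ lam2 f (by omega) hden (Tplus L Δ f)
  set dh : ℝ := (denHE kk.1 kk.2).eval (xTrueD L Δ lam2 f) with hdh
  have hden_eq : den L (Tplus L Δ f) (B1.toTor L kk.1) (B1.toTor L kk.2) = (2 * Real.pi / L) ^ 2 * dh - Tplus L Δ f := by
    rw [hdh]; linarith [ed]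
  have hpos : 0 < dh - τhi := by
    have h2 : 2 * eps1 L ≤ (2 * Real.pi / L) ^ 2 * dh := by simp only at hdlow; linarith [hden_eq]
    have he : eps1 L / (2 * Real.pi / L) ^ 2 ≤ dh / 2 := by rw [div_le_iff₀ ht]; linarith
    linarith
  have hden_lb : (2 * Real.pi / L) ^ 2 * (dh - τhi) ≤ den L (Tplus L Δ f) (B1.toTor L kk.1) (B1.toTor L kk.2) := by
    rw [hden_eq]; nlinarith
  -- evaluate termE
  have eT : (termEX czE ws τlo τhi kk.1 kk.2).eval (xTrueD L Δ lam2 f) = A ^ 2 * (dh - τhi)⁻¹ := by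
    simp only [termEX, RExpr.eval, cst, hA, hdh]
  rw [eT, Complex.normSq_eq_norm_sq]
  have hsq : ‖cfgDFT L (resid L Δ f) (B1.toTor L kk.1) (B1.toTor L kk.2)‖ ^ 2 ≤ (((L : ℝ) ^ 2) ^ 2 * (2 * Real.pi / L) ^ 2 * A) ^ 2 :=
    pow_le_pow_left₀ (norm_nonneg _) hR 2
  calc ‖cfgDFT L (resid L Δ f) (B1.toTor L kk.1) (B1.toTor L kk.2)‖ ^ 2
          / (((L : ℝ) ^ 2) ^ 2 * den L (Tplus L Δ f) (B1.toTor L kk.1) (B1.toTor L kk.2))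
      ≤ (((L : ℝ) ^ 2) ^ 2 * (2 * Real.pi / L) ^ 2 * A) ^ 2 / (((L : ℝ) ^ 2) ^ 2 * ((2 * Real.pi / L) ^ 2 * (dh - τhi))) := by
        apply div_le_div₀ (by positivity) hsq (by positivity)
        exact mul_le_mul_of_nonneg_left hden_lb (by positivity)
    _ = ((L : ℝ) ^ 2) ^ 2 * (2 * Real.pi / L) ^ 2 * (A ^ 2 * (dh - τhi)⁻¹) := by
        field_simp


/-- ★★★ **ORBIT FORM of the Stage-2 certificate, generic zone constant**: `repsZ` (zero-order `classCheckX`) `++` `repsS` (first-order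
`classCheckXS`), the table hypothesis for every class of `lowList`, the orbit table, the budget, the `ê₁`/`τ` checks ⟹
`lowGForm ≤ a_D·η_eff·U` on the cell for every `L ≥ 128`. -/
theorem lowG_of_orbitChecksXS (czE : RExpr) (c : L2.NamedCell) {cz : ℝ} (hcz0 : 0 ≤ cz)
    (hwg : ∀ q : Tor L, ∀ e ∈ E4, (wnorm L q (B1.toTor L e) * gres L lam2 q) ^ 2 ≤ cz * gres L lam2 q)
    (hcz : czE.eval (xTrueD L Δ lam2 f) = cz) (ws : ℤ × ℤ → ℤ × ℤ → ℚ)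
    (hwsAll : ∀ kk ∈ lowList, ∀ e ∈ E4, ∀ d ∈ sssShifts kk,
      ((2 * Real.pi / L) ^ 2) ^ 2 * B1.wloopSum L lam2 0 d d e e ≤ wsR ws e d)
    (a1 a2 aD τlo τhi : ℚ) (pi piT : ℕ × ℕ)
    (repsZ repsS : List (((ℤ × ℤ) × (ℤ × ℤ)) × ℚ)) (orb : List (((ℤ × ℤ) × (ℤ × ℤ)) × (ℕ × List ℕ)))
    (hrepsMem : ((repsZ ++ repsS).all fun p => decide (p.1 ∈ lowList)) = true)
    (hrepsZ : (repsZ.all fun p => classCheckX czE ws c a1 a2 τlo τhi pi p.1 p.2) = true)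
    (hrepsS : (repsS.all fun p => classCheckXS czE ws c a1 a2 τlo τhi pi p.1 p.2) = true)
    (horb : orb.map Prod.fst = lowList) (hok : (orb.all (orbitRowOk (repsZ ++ repsS))) = true)
    (hsum : (orb.map (orbitBudget (repsZ ++ repsS))).sum ≤ 3 * (98696 / 10000) * aD * ((c.n1 : ℚ) / c.νd) * τlo)
    (haD : 0 ≤ aD) (hτlo0 : 0 ≤ τlo) (he1 : e1Check c a1 a2 τhi pi = true) (hτ : tauCheck c a1 a2 τlo τhi piT = true)
    (hc : c.check = true) (hL : 128 ≤ L)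
    (hΔ0 : 0 ≤ Δ) (hΔ1 : Δ < 1) (hf : IsGroundTwoMagnon L Δ lam2 f)
    (hν1 : (c.n1 : ℝ) / c.νd ≤ lam2 / (2 * Real.pi / L) ^ 2) (hν2 : lam2 / (2 * Real.pi / L) ^ 2 ≤ (c.n2 : ℝ) / c.νd)
    (ha1 : ((a1 : ℚ) : ℝ) ≤ Δ * f (K1 L)) (ha2 : Δ * f (K1 L) ≤ ((a2 : ℚ) : ℝ)) :
    lowGForm L Δ f ≤ (aD : ℝ) * etaEff L lam2 * Uunit L Δ f := by
  have hLpos : (0 : ℝ) < L := by exact_mod_cast (show 0 < L by omega)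
  obtain ⟨hτlo, hτhi⟩ := tau_of_tauCheck L Δ lam2 f c a1 a2 τlo τhi piT hτ hc hL hΔ0 hΔ1 hf hν1 hν2 ha1 ha2
  -- the box and the `ê₁` check
  unfold e1Check at he1
  split at he1
  · exact absurd he1 (by simp)
  · rename_i B hB
    have hmem := rowDBox_mem L Δ lam2 f c a1 a2 pi hB hc hL hΔ0 hΔ1 hf hν1 hν2 ha1 ha2
    have e1 := rexprLeOn_sound he1 _ hmem
    simp only [RExpr.eval, cst, vE1, xTrueD_e1] at e1
    push_cast at e1
    have he1' : (τhi : ℝ) - 2 * (eps1 L / (2 * Real.pi / L) ^ 2) ≤ -1 / 1000 := by linarith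
    -- the representatives: `T(r_j) ≤ V²t·b_j` (zero-order rows and first-order rows)
    have hrep : ∀ r ∈ repsZ ++ repsS, lowTerm L Δ f (B1.toTor L r.1.1) (B1.toTor L r.1.2)
        ≤ ((L : ℝ) ^ 2) ^ 2 * (2 * Real.pi / L) ^ 2 * ((r.2 : ℚ) : ℝ) := by
      intro r hr
      have hmemL : r.1 ∈ lowList := of_decide_eq_true (List.all_eq_true.mp hrepsMem r hr)
      have h1 := class_leX L Δ lam2 f czE hcz0 hwg hcz hL hΔ0 hΔ1 hf τlo τhi hτlo hτhi he1' ws hmemL (hwsAll r.1 hmemL)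
      have h3 : (termEX czE ws τlo τhi r.1.1 r.1.2).eval (xTrueD L Δ lam2 f) ≤ ((r.2 : ℚ) : ℝ) := by
        rcases List.mem_append.mp hr with hz | hs
        · have hcls := List.all_eq_true.mp hrepsZ r hz
          unfold classCheckX at hcls
          rw [hB] at hcls
          exact rexprLeOn_sound hcls _ hmem
        · exact classCheckXS_sound (List.all_eq_true.mp hrepsS r hs) hB hmem
      exact h1.trans (mul_le_mul_of_nonneg_left h3 (by positivity))
    -- the rows: `T(k) = T(w·k) = T(r_j) ≤ V²t·b_j`
    refine lowG_of_rowBounds L Δ lam2 f (by omega) hΔ1 hf c aD τlo (orb.map fun row => (row.1, orbitBudget (repsZ ++ repsS) row))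
      (by rw [List.map_map]; exact horb) ?_ (by rw [List.map_map]; exact hsum) haD hτlo0 hτlo hν1
    intro p hp
    obtain ⟨row, hrow, rfl⟩ := List.mem_map.mp hp
    have hok1 := List.all_eq_true.mp hok row hrow
    unfold orbitRowOk at hok1
    unfold orbitBudget
    split at hok1
    · exact absurd hok1 (by simp)
    · rename_i r hr
      have hw : wordZ row.2.2 row.1 = r.1 := of_decide_eq_true hok1
      have hrmem : r ∈ repsZ ++ repsS := List.mem_of_getElem? hr
      have key := lowTerm_wordZ L (by omega) hf row.2.2 row.1
      rw [hw] at key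
      show lowTerm L Δ f (B1.toTor L row.1.1) (B1.toTor L row.1.2) ≤ _
      rw [← key]
      exact hrep r hrmem

/-- ★★★ **THE STAGE-2 `c_W` CELL CERTIFICATE with a certified `WS` table** (the form cell files use): `ws`, `dset` with
`hcov` (every class shift lies in `dset`; `B1.wsDSetB<band>_covers`) and `hadm` (the table bounds `θ⁴·wloopSum L (νθ²) 0 d d e e` on
`E4 × dset` at `ν = λ₂/θ²`; `B1.wsTabB<band>_adm`), `repsZ` by `classCheckWX`, `repsS` by `classCheckWXS`, orbit table, budget, `ê₁`/`τ`
checks ⟹ `lowGForm ≤ a_D·η_eff·U` on the cell for every `L ≥ 128`. -/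
theorem lowG_of_orbitChecksWXS (c : L2.NamedCell) (ws : ℤ × ℤ → ℤ × ℤ → ℚ) (dset : List (ℤ × ℤ))
    (hcov : ∀ kk ∈ lowList, ∀ d ∈ sssShifts kk, d ∈ dset)
    (hadm : ∀ e ∈ E4, ∀ d ∈ dset, ((2 * Real.pi / L) ^ 2) ^ 2
      * B1.wloopSum L (lam2 / (2 * Real.pi / L) ^ 2 * (2 * Real.pi / L) ^ 2) (0, 0) d d e e ≤ ((ws e d : ℚ) : ℝ))
    (a1 a2 aD τlo τhi : ℚ) (pi piT : ℕ × ℕ)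
    (repsZ repsS : List (((ℤ × ℤ) × (ℤ × ℤ)) × ℚ)) (orb : List (((ℤ × ℤ) × (ℤ × ℤ)) × (ℕ × List ℕ)))
    (hrepsMem : ((repsZ ++ repsS).all fun p => decide (p.1 ∈ lowList)) = true)
    (hrepsZ : (repsZ.all fun p => classCheckWX ws c a1 a2 τlo τhi pi p.1 p.2) = true)
    (hrepsS : (repsS.all fun p => classCheckWXS ws c a1 a2 τlo τhi pi p.1 p.2) = true)
    (horb : orb.map Prod.fst = lowList) (hok : (orb.all (orbitRowOk (repsZ ++ repsS))) = true)
    (hsum : (orb.map (orbitBudget (repsZ ++ repsS))).sum ≤ 3 * (98696 / 10000) * aD * ((c.n1 : ℚ) / c.νd) * τlo)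
    (haD : 0 ≤ aD) (hτlo0 : 0 ≤ τlo) (he1 : e1Check c a1 a2 τhi pi = true) (hτ : tauCheck c a1 a2 τlo τhi piT = true)
    (hc : c.check = true) (hL : 128 ≤ L)
    (hΔ0 : 0 ≤ Δ) (hΔ1 : Δ < 1) (hf : IsGroundTwoMagnon L Δ lam2 f)
    (hν1 : (c.n1 : ℝ) / c.νd ≤ lam2 / (2 * Real.pi / L) ^ 2) (hν2 : lam2 / (2 * Real.pi / L) ^ 2 ≤ (c.n2 : ℝ) / c.νd)
    (ha1 : ((a1 : ℚ) : ℝ) ≤ Δ * f (K1 L)) (ha2 : Δ * f (K1 L) ≤ ((a2 : ℚ) : ℝ)) :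
    lowGForm L Δ f ≤ (aD : ℝ) * etaEff L lam2 * Uunit L Δ f := by
  have hLpos : (0 : ℝ) < L := by exact_mod_cast (show 0 < L by omega)
  have ht : (2 * Real.pi / L : ℝ) ^ 2 ≠ 0 := by positivity
  have hlam : lam2 / (2 * Real.pi / L) ^ 2 * (2 * Real.pi / L) ^ 2 = lam2 := div_mul_cancel₀ lam2 ht
  have hwsAll : ∀ kk ∈ lowList, ∀ e ∈ E4, ∀ d ∈ sssShifts kk,
      ((2 * Real.pi / L) ^ 2) ^ 2 * B1.wloopSum L lam2 0 d d e e ≤ wsR ws e d := by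
    intro kk hkk e he d hd
    have h := hadm e he d (hcov kk hkk d hd)
    rw [hlam] at h
    exact h
  obtain ⟨hcz0, hwg⟩ := wg_hypW L Δ lam2 f hL hΔ0 hΔ1 hf
  exact lowG_of_orbitChecksXS L Δ lam2 f cWE c hcz0 hwg (eval_cWE L Δ lam2 f hL hΔ0 hf) ws hwsAll a1 a2 aD τlo τhi pi piT
    repsZ repsS orb hrepsMem hrepsZ hrepsS horb hok hsum haD hτlo0 he1 hτ hc hL hΔ0 hΔ1 hf hν1 hν2 ha1 ha2

end sound

end RowD

end Summit.HubbardSuperconductivity.HubbardSuperconductivity.Theorems.AnisotropyChord.Transfer.Fibre3
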